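import Mathlib
import HarnessLib
import HarnessLib.Audit
import Summits.Parity.Statement
import Literature.Barriers.Parity.SiegelZeroDichotomy

/-!
Route: ArtinGenericSplit

DORMANT since 2026-09-04T15:06:10Z (reconciler: no traction for 5 d (last activity statement-checked at 2026-08-30T14:13:25Z); parked, not closed — `ledger route dormant route-Parity-ArtinGenericSplit --off` to reactivate) — unstaffed, not closed; items shared with open routes are served there. `ledger route dormant <id> --off` reactivates.

# Route ArtinGenericSplit — GHL ⟸ the record's Siegel/upper/uniform leaves ∧ Artin's conjecture for
the base 2 ∧ the lift Artin(2) → fixed-pattern lower bound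

decomp-parity (D-0178/D-0179) lens-2 g6 node «ArtinGenericSplit» (RESIDUAL mode, critic CLEARED
HOME/STATUS.md l.255, CRITIC-LEDGER row 54;
filing (B) standalone endorsed there): an ALTERNATIVE DECOMPOSITION of the record route
route-Parity-SiegelSpectrumSplit beneath its fixed-pattern
lower leaf FL = stmt-Parity-26863, on an axis disjoint from lens-6's
route-Parity-GhostBoundaryCarving. It suffices to show
X = Q ∧ FixedUpper ∧ UniformUpperGivenFixed ∧ ArtinTwo ∧ ArtinLift ∧ UniformLowerGivenFixed, where Q
(25148), FixedUpper (26852),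
UniformUpperGivenFixed (26853), UniformLowerGivenFixed (26864) are the record's items VERBATIM
(shared by signature), ArtinTwo := «there are
infinitely many primes p with orderOf (2 : ZMod p) = p − 1» (Artin's primitive-root conjecture for
the base 2, qualitative: the GENERIC class of
the special/generic dichotomy of primes by Kummer-splitting type) and ArtinLift := ArtinTwo →
FixedLower (the declared residual: all parity content).
Kernel (HOME/decomp-parity-lens-2/g6/ArtinGenericSplit.lean, rc 0): FixedLower ↔ ArtinTwo ∧
ArtinLift (fixedLower_iff, via the NEW leaf-level necessity
theorem dicksonConjecture_of_fixedLower : FixedLower → DicksonConjecture and the face (n, 4n+1));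
closes with 6/6 binders through the born
SiegelSpectrumSplit.closes and the CLOSED glue theorems; node_iff : GHL ↔ X modulo the record's own
GHL ⟹ Q hypothesis (critic P4).
Lean: `(∃ η₀ : ℝ, ∃ q₀ : ℕ, ∀ (q : ℕ) [NeZero q] (χ : DirichletCharacter ℂ q) (η : ℝ), q₀ ≤ q →
Literature.Barriers.Parity.IsSiegelZero χ η → η < η₀) ∧ (∀ (d t : ℕ), 1 ≤ d → 1 ≤ t → ∀ Ψ : Fin t →
Literature.NumberTheory.Sieve.AffLinForm d, Literature.NumberTheory.Sieve.IsNondegenerateSystem Ψ →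
∀ ε : ℝ, 0 < ε → ∃ N₀ : ℕ, ∀ N : ℕ, N₀ ≤ N → ∀ K : Set (Fin d → ℝ), Convex ℝ K → K ⊆
Literature.NumberTheory.Sieve.realBox d N → Literature.NumberTheory.Sieve.vonMangoldtSum Ψ K N -
Literature.NumberTheory.Sieve.archFactor Ψ K * Literature.NumberTheory.Sieve.singularProduct Ψ ≤ ε *
(N : ℝ) ^ d) ∧ ((∃ η₀ : ℝ, ∃ q₀ : ℕ, ∀ (q : ℕ) [NeZero q] (χ : DirichletCharacter ℂ q) (η : ℝ), q₀ ≤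
q → Literature.Barriers.Parity.IsSiegelZero χ η → η < η₀) → (∀ (d t : ℕ), 1 ≤ d → 1 ≤ t → ∀ Ψ : Fin
t → Literature.NumberTheory.Sieve.AffLinForm d, Literature.NumberTheory.Sieve.IsNondegenerateSystem
Ψ → ∀ ε : ℝ, 0 < ε → ∃ N₀ : ℕ, ∀ N : ℕ, N₀ ≤ N → ∀ K : Set (Fin d → ℝ), Convex ℝ K → K ⊆
Literature.NumberTheory.Sieve.realBox d N → Literature.NumberTheory.Sieve.vonMangoldtSum Ψ K N -
Literature.NumberTheory.Sieve.archFactor Ψ K * Literature.NumberTheory.Sieve.singularProduct Ψ ≤ ε *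
(N : ℝ) ^ d) → ∀ (d t L : ℕ), 1 ≤ d → 1 ≤ t → ∀ ε : ℝ, 0 < ε → ∃ N₀ : ℕ, ∀ N : ℕ, N₀ ≤ N → ∀ Ψ : Fin
t → Literature.NumberTheory.Sieve.AffLinForm d, Literature.NumberTheory.Sieve.IsNondegenerateSystem
Ψ → Literature.NumberTheory.Sieve.affLinSize Ψ N ≤ L → ∀ K : Set (Fin d → ℝ), Convex ℝ K → K ⊆
Literature.NumberTheory.Sieve.realBox d N → Literature.NumberTheory.Sieve.vonMangoldtSum Ψ K N -
Literature.NumberTheory.Sieve.archFactor Ψ K * Literature.NumberTheory.Sieve.singularProduct Ψ ≤ ε *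
(N : ℝ) ^ d) ∧ ({p : ℕ | p.Prime ∧ orderOf (2 : ZMod p) = p - 1}.Infinite) ∧ ({p : ℕ | p.Prime ∧
orderOf (2 : ZMod p) = p - 1}.Infinite → ∀ (d t : ℕ), 1 ≤ d → 1 ≤ t → ∀ Ψ : Fin t →
Literature.NumberTheory.Sieve.AffLinForm d, Literature.NumberTheory.Sieve.IsNondegenerateSystem Ψ →
∀ ε : ℝ, 0 < ε → ∃ N₀ : ℕ, ∀ N : ℕ, N₀ ≤ N → ∀ K : Set (Fin d → ℝ), Convex ℝ K → K ⊆
Literature.NumberTheory.Sieve.realBox d N → Literature.NumberTheory.Sieve.archFactor Ψ K *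
Literature.NumberTheory.Sieve.singularProduct Ψ - Literature.NumberTheory.Sieve.vonMangoldtSum Ψ K N
≤ ε * (N : ℝ) ^ d) ∧ ((∃ η₀ : ℝ, ∃ q₀ : ℕ, ∀ (q : ℕ) [NeZero q] (χ : DirichletCharacter ℂ q) (η :
ℝ), q₀ ≤ q → Literature.Barriers.Parity.IsSiegelZero χ η → η < η₀) → (∀ (d t : ℕ), 1 ≤ d → 1 ≤ t → ∀
Ψ : Fin t → Literature.NumberTheory.Sieve.AffLinForm d,
Literature.NumberTheory.Sieve.IsNondegenerateSystem Ψ → ∀ ε : ℝ, 0 < ε → ∃ N₀ : ℕ, ∀ N : ℕ, N₀ ≤ N →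
∀ K : Set (Fin d → ℝ), Convex ℝ K → K ⊆ Literature.NumberTheory.Sieve.realBox d N →
Literature.NumberTheory.Sieve.archFactor Ψ K * Literature.NumberTheory.Sieve.singularProduct Ψ -
Literature.NumberTheory.Sieve.vonMangoldtSum Ψ K N ≤ ε * (N : ℝ) ^ d) → ∀ (d t L : ℕ), 1 ≤ d → 1 ≤ t
→ ∀ ε : ℝ, 0 < ε → ∃ N₀ : ℕ, ∀ N : ℕ, N₀ ≤ N → ∀ Ψ : Fin t →
Literature.NumberTheory.Sieve.AffLinForm d, Literature.NumberTheory.Sieve.IsNondegenerateSystem Ψ →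
Literature.NumberTheory.Sieve.affLinSize Ψ N ≤ L → ∀ K : Set (Fin d → ℝ), Convex ℝ K → K ⊆
Literature.NumberTheory.Sieve.realBox d N → Literature.NumberTheory.Sieve.archFactor Ψ K *
Literature.NumberTheory.Sieve.singularProduct Ψ - Literature.NumberTheory.Sieve.vonMangoldtSum Ψ K N
≤ ε * (N : ℝ) ^ d)`

## Assembly
Pure logic plus |a − b| ≤ c ⟺ (a − b ≤ c ∧ b − a ≤ c): hUU hQ hFU is the uniform upper half, hUL hQ
(hR hA) the uniform lower half (ArtinLift consumes
ArtinTwo and yields FixedLower), and the two halves with N₀ := max give GHL (`closes` in glue.lean,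
6/6 binders consumed). Exactness in the cell file:
fixedLower_iff (FixedLower ↔ ArtinTwo ∧ ArtinLift, kernel, via dicksonConjecture_of_fixedLower) and
node_iff (GHL ↔ X MODULO the record's own necessity
hypothesis GHL ⟹ Q — stated here per critic P4; the record carries the same caveat).

Rationale: WHY THIS LINE. Lens 2 «special vs generic» applied to the PRIME rather than to the pattern: for the
base 2 every odd prime p is either SPECIAL (some prime ℓ ∣ p−1 has
2^((p−1)/ℓ) ≡ 1 (mod p): p splits completely in the Kummer field ℚ(ζ_ℓ, 2^(1/ℓ))) or GENERIC (2
generates (ℤ/p)ˣ), and the leaf's own prime pairs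
(q, 4q+1) are structured certificates of genericity (p = 4q+1 ≡ 5 (mod 8) kills ℓ = 2 by the second
supplement, ℓ = q would force p ∣ 15); the
structured family is leaf-class («as difficult as the twin prime question»,
book:cojocaru2005-introduction-sieve-methods-their-applications §10.4;
Moree2012ArtinSurvey §5.1), the generic CLASS is Artin's conjecture, which is a THEOREM under GRH
(Hooley1967; Lenstra1977 Thm (8.3); Moree1999 Thm 2 —
the tree's named fact
Literature.NumberTheory.Multiplicative.lenstra1977_exists_prime_two_primitiveRoot_progression_of_ERH)
because it is a
DIMENSION-ZERO Frobenian sieve: one prime variable, Chebotarev conditions of density 1/(ℓ(ℓ−1))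
summable in ℓ (arXiv:math/0412262 §5), whereas a prime
pair is dimension ≥ 1 and GRH/EH/GEH do not beat parity there
(Literature.Barriers.Parity.PrimePairParity, SelbergParity). Imported: algebraic number
theory / Chebotarev–Kummer theory (Artin's heuristic, Hooley's conditional proof), the sieve results
of GuptaMurty1984 / HeathBrown1986Artin as the printed
unconditional floor («one of 2, 3, 5»; no single base known: Moree2012ArtinSurvey §5.1), and for the
kernel necessity theorem Green–Tao's d = 1 dictionary
(GreenTao2010 Def. 1.1 / Conj. 1.2) with Chebyshev's ψ − ϑ bound (Mathlib). Versus prior routes and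
the negatives index: no Parity route, card-route or
refuted statement uses the multiplicative order of a fixed base (rg over Theses/, Barriers/Parity,
the cell census v1–v5, ledger negatives: 0 hits); the
nearest cell node, GhostBoundaryCarving, weakens the SAME pattern statement by an existence
threshold separated by GEH, while this line weakens through
a HOMOMORPHIC IMAGE into (ℤ/p)ˣ separated by GRH via Chebotarev — neither piece implies the other.

RANKED CRUXES. #2 ArtinTwo (crux) — Artin's primitive-root conjecture for the base 2, qualitative
form: infinitely many primes p with 2 a primitive root mod p (orderOf (2 : ZMod p) = p − 1).
NECESSARY (kernel: FixedLower ⟹ DicksonConjecture ⟹ pair (n, 4n+1) ⟹ ArtinTwo; also from GHL, from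
BH given BH ⟹ Dickson, and hypothesis-free from Parity) and STRICTLY WEAKER at NAMED-FACT grade:
ERH-DECIDED (Hooley 1967 via the tree fact
lenstra1977_exists_prime_two_primitiveRoot_progression_of_ERH, M = 8, r = 3) while FixedLower is
open under ERH. Credit in ARTIN currency only, never distance to the summit; printed floors |S| = 3
unconditional (Gupta–Murty 1984 / Heath-Brown 1986: one of 2, 3, 5), |S| = 2 under EH
(Cojocaru–Murty §10.4 Ex. 9), |S| = 1 = this literal, GRH-class («no g with P(g) known infinite»,
Moree survey §5.1). IDEA-NEEDED unconditionally (GRH-free Chebotarev in Kummer towers) — NOT for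
provers now (critic P1): staffable work = landing the kernel necessity theorems
(dicksonConjecture_of_fixedLower, artinTwo_of_fixedLower, fixedLower_iff) under Theorems/ --supports
stmt-Parity-26863; instrument ladders (|S| = 3 → 2 → 1; ord_p(2) > p^θ i.o., θ = 0.677 Baker–Harman)
at zero credit; SIEGEL-INERT. [difficulty: open-problem] (why it might fail: Kernel-implied by GHL
(and by BH given BH ⟹ Dickson), so false only with Parity; live risk = unprovable now: no base g has
P(g) known infinite (Moree §5.1); sieves stop at «one of three» (P₂ floor), Hooley needs RH for all
Kummer fields k_l.) [Hooley1967, HeathBrown1986Artin, GuptaMurty1984, Moree2012ArtinSurvey,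
Moree1999, Lenstra1977, arXiv:math/0412262,
book:cojocaru2005-introduction-sieve-methods-their-applications]
#3 ArtinLift (crux) — ArtinTwo → FixedLower (the record leaf stmt-Parity-26863, text verbatim): from
«2 is a primitive root for infinitely many primes» to the one-sided Hardy–Littlewood lower bound
archFactor·singularProduct − vonMangoldtSum ≤ εN^d for every fixed non-degenerate affine-linear
system — DECLARED RESIDUAL (all parity content; zero credit; never staffed; TERMINAL on this axis:
the day ArtinTwo lands it is FixedLower itself and the route contracts onto the record). [deps:
ArtinTwo] [difficulty: open-problem] (why it might fail: Kernel-implied by GHL; as an implication it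
must manufacture prime PAIRS with the HL constant from a ONE-prime statement about (ℤ/p)ˣ — head-on
against PrimePairParity / SelbergParity / FordMaynard; no mechanism in print links ord_p(2) to pair
counts.) [GreenTao2010, Hooley1967, FordMaynard2024PrimeSieves, Selberg1949,
Literature.Barriers.Parity.PrimePairParity, Literature.Barriers.Parity.SelbergParity]
#4 UniformLowerGivenFixed (crux) — the record's item stmt-Parity-26864 verbatim (Q → FixedLower →
the uniform lower half of GHL); shared by signature, filing fields = the record's. [difficulty:
open-problem] (why it might fail: It contains binary Goldbach with the Hardy–Littlewood main term
for every large even N, given Q and the tuples: no method controls an individual shift h ≍ N;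
almost-all-h results (MRT 2019, window N^(8/33)) are the ceiling.) [GreenTao2010,
HardyLittlewood1923, MatomakiRadziwillTao2019, MatomakiMerikoski2023,
Literature.Barriers.Parity.CircleMethodBinary]
#5 UniformUpperGivenFixed (crux) — the record's item stmt-Parity-26853 verbatim (Q → FixedUpper →
the uniform upper half of GHL); shared by signature, filing fields = the record's. [difficulty:
open-problem] (why it might fail: It is the uniform-in-shift (binary Goldbach-type) upper bound with
factor 1+ε given Q and all tuples: pointwise-in-h control beyond windows N^(8/33) (MRT 2019) is
open; the circle method misses binary minor arcs by log x.) [GreenTao2010, MatomakiRadziwillTao2019,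
MatomakiMerikoski2023, Literature.Barriers.Parity.TrueComplexityBinary,
Literature.Barriers.Parity.CircleMethodBinary]
#6 BoundedSiegelZeroQuality (crux) — the record's Siegel crux stmt-Parity-25148 verbatim
(exceptional zeros have bounded quality η); shared by signature, filing fields = the record's.
[difficulty: open-problem] (why it might fail: it is the Landau–Siegel problem: no unconditional
bound on η is known (Siegel's theorem is ineffective); a genuine open problem, not a lemma.)
[HeathBrown1983PrimeTwins, MatomakiMerikoski2023, TaoTeravainen2021]
#7 FixedUpper (crux) — the record's item stmt-Parity-26852 verbatim (upper half of GT Conj. 1.2 for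
every fixed non-degenerate system); shared by signature, filing fields = the record's. [difficulty:
open-problem] (why it might fail: As a target it contains the upper prime k-tuples bound with
constant 1+ε for every fixed tuple: Type-I sieves stop at factor 2 (Selberg parity,
LinearSieveOptimality); record 3.2996 for twins; open even under GRH.) [GreenTao2010,
HardyLittlewood1923, Selberg1949, Literature.Barriers.Parity.SelbergParity,
Literature.Barriers.Parity.LinearSieveOptimality]

TWO-LAYER PLAN. None at open. ArtinTwo is a literal terminal notch (base 2, «infinitely many») and
is never split by base, by candidate set or by index exponent (the
ladders |S| = 3 → 2 → 1 and ord_p(2) > p^θ are INSTRUMENTS with zero distance credit; another base g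
is the same notch up to the Lenstra–Moree dictionary —
an «ArtinThree» node would be VARIANT, critic l.255). The only foreseen split is Hooley's: ArtinTwo
⇐ (RH for the Kummer fields k_l, uniformly) → (Chebotarev
+ convergent tail ⟹ ArtinTwo) — filed, if ever, as the BC3 skeleton's stubs, not as items. ArtinLift
is a residual and is never split. If ArtinTwo lands,
ArtinLift ≡ FixedLower (costume) and the lower side of this route is superseded by the record
(declared).

KILL CRITERIA. A refutation of ArtinTwo refutes FixedLower, GHL and (given BH ⟹ Dickson) BH — kernel
necessity: route, sub-problem and summit close refuted together;
conversely «FixedLower does NOT imply ArtinTwo» is impossible (kernel theorem). A landed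
unconditional theorem «2 is a primitive root for infinitely many
primes» closes ArtinTwo and collapses the route onto the record (ArtinLift becomes FL: superseded,
declared). A tribunal finding that ArtinTwo is a RUNG /
adjacent programme rather than a piece (T13 drift) retires the route to the census; the kernel
theorems dicksonConjecture_of_fixedLower /
artinTwo_of_fixedLower survive as support landings on 26863.

NOT DECOMPOSED YET. ArtinTwo is not decomposed into «ERH» ∧ «ERH → ArtinTwo» at open (the second is
a printed theorem vendored as a named fact, the first is GRH itself and would
be the whole crux: a one-real-piece split, and ERH is not NECESSARY for FixedLower). The finite
Kummer layers R_L («infinitely many p generic at every prime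
ℓ ≤ L», a theorem for every L by Dirichlet/Chebotarev) are NOT filed (instrument rungs; R_7 is the
BC5 kernel rung). The structured sub-family
«infinitely many q with q, 4q+1 prime» is NOT filed as a piece (leaf-class: it is a Dickson pair,
kernel fourMulAddOne_infinite_of_fixedLower). No other
base, no near-primitive-root (index t) variant, no average-over-g statement (Stephens/Goldfeld:
theorems, T8) is filed.

CHEAPEST FALSIFIER. (i) Theorem test (T8): is ArtinTwo already a theorem? No — «There is no known
number g for which P(g) is known to be infinite» (Moree2012ArtinSurvey §5.1;
Heath-Brown 1986 gives one of 2, 3, 5); lean search 'orderOf (2 : ZMod' / 'primitiveRoot' finds only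
the ERH named fact and unrelated cyclotomic files.
(ii) Drift test (T13): the critic ruled (row 54): on-face kernel chain, printed METHOD floors,
independence of 29350, terminal contraction ⟹ a credited piece.
(iii) Vacuity: Artin primes exist (3, 5, 11, 13, 19, 29, …; kernel isArtinPrime_nineteen), p = 2 is
excluded automatically (orderOf 0 = 0 ≠ 1), the set is
not provably infinite by a trivial witness; ArtinLift is not vacuous (ArtinTwo is consistent:
implied by GHL, true under ERH). (iv) C → S probes: ArtinTwo ⇏ GHL
cheaply (BC2/BC7 P5 batteries fail); ArtinTwo ⇏ FixedLower cheaply (that is the residual).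

NUMBERS. Artin's constant A = ∏_ℓ (1 − 1/(ℓ(ℓ−1))) ≈ 0.3739558 (conjectured density of ArtinTwo's
set among primes; under GRH a theorem, Hooley1967). Unconditional:
one of 2, 3, 5 is a primitive root for infinitely many p; at most two prime bases and three
square-free bases are exceptional (HeathBrown1986Artin, improving
GuptaMurty1984: one of 13 bases); under EH: one of any two primes (book:cojocaru2005 §10.4 Ex. 9).
Index ladder: P⁺(p−1) > p^0.677 infinitely often
(Baker–Harman 1998, doi:10.4064/aa-83-4-331-361) ⟹ ord_p(2) > p^0.677 infinitely often. Structured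
certificates: p = 4q+1 (q ≥ 3 prime) and p = 2q+1
(q ≡ 1 mod 4 prime) are Artin primes; 19 is an Artin prime in neither family.

DEFINITION REQUESTS. None: every item is stated over existing declarations (Mathlib orderOf / ZMod /
Set.Infinite; Literature.NumberTheory.Sieve.{AffLinForm,
IsNondegenerateSystem, affLinSize, realBox, vonMangoldtSum, archFactor, singularProduct};
Literature.Barriers.Parity.IsSiegelZero; DirichletCharacter).
Cite fact wanted later (instrument, not load-bearing): HeathBrown1986Artin Cor. «one of 2, 3, 5» as
a Literature named fact.

Novelty: Searches (2026-08-30): lean search 'primitiveRoot|orderOf (2 : ZMod|ArtinConstant|HeathBrown1986'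
(tree: only Literature.NumberTheory.Multiplicative.ArtinPrimitiveRootProgressions = the ERH named
fact, cyclotomic/RecurringDecimals files; no Theses item, no barrier); rg 'artin|primitive
root|orderOf' over the cell HOME (STATUS, TREE v4.14, CRITIC-LEDGER, census v1–v5): 0 hits; ledger
negatives --problem Parity (5 entries): 0 hits; lit search --hybrid "Artin primitive root conjecture
twin prime 4q+1" / "Hooley Artin GRH unconditional Heath-Brown" (corpus: paper:arxiv-math_0412262
§5/§5.1, book:cojocaru2005-introduction-sieve-methods-their-applications chunk p.115/p.118,
book:guy1994-unsolved-problems-number-theory F9 p.252–253); lit galaxy search "Artin's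
conjecture|primitive root" --star all / pdf / panama ([galaxy:pdf:-7529409174361946500] Moree
«Near-primitive roots», [galaxy:pdf:1861945260] Moree on order and index,
[galaxy:pdf:-3245695380901221240] Frei–Koymans–Sofos, [galaxy:panama:513317311348797]
Cojocaru–Murty); lit search "Baker Harman shifted primes large prime factor 0.677"
([corpus:paper:arxiv-2305.14776 p.3], [corpus:paper:arxiv-2508.18285 p.32], crossref
doi:10.4064/aa-83-4-331-361).
Nearest prior art found: Hooley1967 (GRH ⟹ Artin, the separation), HeathBrown1986Artin /
GuptaMurty1984 (the unconditional floor), Moree2012ArtinSurvey §5.1 (records both and the remark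
that the structured family q = 4p+1 is sieve-inaccessible), book:cojocaru2005 §10.4 («as difficult  [refs: 10.4064/aa-83-4-331-361, paper:arxiv-math_0412262, book:cojocaru2005-introduction-sieve-methods-their-applications, book:guy1994-unsolved-problems-number-theory, paper:arxiv-2305.14776, paper:arxiv-2508.18285, doi:10.4064/aa-83-4-331-361, book:cojocaru2005, Hooley1967, GuptaMurty1984]

Barriers (technique_class: decomposition, artin-primitive-root, chebotarev-kummer): - technique_class: decomposition, artin-primitive-root, chebotarev-kummer
- Literature.Barriers.Parity.PrimePairParity: ArtinTwo is OUTSIDE — the barrier quantifies over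
sieve-theoretic deductions for a prime-PAIR set (twinSet / gapFourSet with Liouville-twisted
weights); Artin's set is ONE prime with Chebotarev conditions of summable density, and Hooley's
argument is Chebotarev + a convergent tail, not a weighted detection sum; ArtinLift is INSIDE
head-on (it must name the pair with the HL constant), declared residual.
- Literature.Barriers.Parity.SelbergParityBarrier: OUTSIDE for ArtinTwo (no Type-I lower-bound sieve
for a parity-odd set is asked: genericity is a condition on Frobenius classes in Kummer fields,
dimension zero); INSIDE head-on for ArtinLift (residual).
- Literature.Barriers.Parity.FordMaynardMinimalTypeII: not engaged by ArtinTwo as a statement (the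
barrier concerns detecting primes in ONE sifted sequence from Type I/II information; the
unconditional floor HB86 does sieve p−1 and stops at P₂ = «one of three» — exactly the printed floor
the crux declares, so an unconditional proof by sieve alone would have to beat it: the bet is
Chebotarev-type input, not Type II information); ArtinLift inside (residual).
- Literature.Barriers.Parity.TargetGraphParity: not engaged (no threshold target «≥ m of k shifts»;
the hasThresholdGhost LP does not quantify over power-residue conditions on a single prime);
ArtinLift's conclusion lives on the ghosted diagonal cells (k,k)

History (route lifecycle, newest last):
- 2026-09-04T15:06:10Z · DORMANT — reconciler: no traction for 5 d (last activity statement-checked at 2026-08-30T14:13:25Z); parked, not closed — `ledger route dormant route-Parity-ArtinGenericS (operator:999:2087409)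

sub-problem: GeneralizedHardyLittlewood · status: dormant · opened planner-decomp-parity-lens-2-g6-0 2026-08-30T08:02:50Z · rev 0 · ledger route-Parity-ArtinGenericSplit
GENERATED by the gate from the ledger (D-0016/17). Provers cite these decls: `theorem foo : Summit.Parity.GeneralizedHardyLittlewood.Theses.ArtinGenericSplit.<Decl> := …` in Summits/Parity/GeneralizedHardyLittlewood/Theorems/<Name>.lean.
-/

namespace Summit.Parity.GeneralizedHardyLittlewood.Theses.ArtinGenericSplit

open scoped BigOperators Topology Manifold Classical MeasureTheory ProbabilityTheory Matrix InnerProductSpace ComplexConjugate ContinuousMap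
open Filter Set Function TopologicalSpace MeasureTheory

attribute [summit_statement] _root_.GeneralizedHardyLittlewood

/-- item stmt-Parity-30686 · crux · rank 2 · open · by planner
why it might fail: Kernel-implied by GHL (and by BH given BH ⟹ Dickson), so false only with Parity; live risk = unprovable now: no base g has P(g) known infinite (Moree §5.1); sieves stop at «one of three» (P₂ floor), Hooley needs RH for all Kummer fields k_l.
sources: Hooley1967, HeathBrown1986Artin, GuptaMurty1984, Moree2012ArtinSurvey, Moree1999, Lenstra1977
[crux] Artin's primitive-root conjecture for the base 2, qualitative form: infinitely many primes p
with 2 a primitive root mod p (orderOf (2 : ZMod p) = p − 1). NECESSARY (kernel: FixedLower ⟹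
DicksonConjecture ⟹ pair (n, 4n+1) ⟹ ArtinTwo; also from GHL, from BH given BH ⟹ Dickson, and
hypothesis-free from Parity) and STRICTLY WEAKER at NAMED-FACT grade: ERH-DECIDED (Hooley 1967 via
the tree fact lenstra1977_exists_prime_two_primitiveRoot_progression_of_ERH, M = 8, r = 3) while
FixedLower is open under ERH. Credit in ARTIN currency only, never distance to the summit; printed
floors |S| = 3 unconditional (Gupta–Murty 1984 / Heath-Brown 1986: one of 2, 3, 5), |S| = 2 under EH
(Cojocaru–Murty §10.4 Ex. 9), |S| = 1 = this literal, GRH-class («no g with P(g) known infinite»,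
Moree survey §5.1). IDEA-NEEDED unconditionally (GRH-free Chebotarev in Kummer towers) — NOT for
provers now (critic P1): staffable work = landing the kernel necessity theorems
(dicksonConjecture_of_fixedLower, artinTwo_of_fixedLower, fixedLower_iff) under Theorems/ --supports
stmt-Parity-26863; instrument ladders (|S| = 3 → 2 → 1; ord_p(2) > p^θ i.o., θ = 0.677 Baker–Harman)
at zero credit; SIEGEL-INERT. [difficul -/
@[route_item "route-Parity-ArtinGenericSplit"]
def ArtinTwo : Prop :=
  {p : ℕ | p.Prime ∧ orderOf (2 : ZMod p) = p - 1}.Infinite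

/-- item stmt-Parity-30687 · crux · rank 3 · open · by planner
why it might fail: Kernel-implied by GHL; as an implication it must manufacture prime PAIRS with the HL constant from a ONE-prime statement about (ℤ/p)ˣ — head-on against PrimePairParity / SelbergParity / FordMaynard; no mechanism in print links ord_p(2) to pair counts.
sources: GreenTao2010, Hooley1967, FordMaynard2024PrimeSieves, Selberg1949, Literature.Barriers.Parity.PrimePairParity, Literature.Barriers.Parity.SelbergParity
[crux] ArtinTwo → FixedLower (the record leaf stmt-Parity-26863, text verbatim): from «2 is a
primitive root for infinitely many primes» to the one-sided Hardy–Littlewood lower bound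
archFactor·singularProduct − vonMangoldtSum ≤ εN^d for every fixed non-degenerate affine-linear
system — DECLARED RESIDUAL (all parity content; zero credit; never staffed; TERMINAL on this axis:
the day ArtinTwo lands it is FixedLower itself and the route contracts onto the record). [deps:
ArtinTwo] [difficulty: open-problem] -/
@[route_item "route-Parity-ArtinGenericSplit"]
def ArtinLift : Prop :=
  {p : ℕ | p.Prime ∧ orderOf (2 : ZMod p) = p - 1}.Infinite → ∀ (d t : ℕ), 1 ≤ d → 1 ≤ t → ∀ Ψ : Fin t → Literature.NumberTheory.Sieve.AffLinForm d, Literature.NumberTheory.Sieve.IsNondegenerateSystem Ψ → ∀ ε : ℝ, 0 < ε → ∃ N₀ : ℕ, ∀ N : ℕ, N₀ ≤ N → ∀ K : Set (Fin d → ℝ), Convex ℝ K → K ⊆ Literature.NumberTheory.Sieve.realBox d N → Literature.NumberTheory.Sieve.archFactor Ψ K * Literature.NumberTheory.Sieve.singularProduct Ψ - Literature.NumberTheory.Sieve.vonMangoldtSum Ψ K N ≤ ε * (N : ℝ) ^ d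

/-- item stmt-Parity-26864 · crux · rank 4 · open · by planner
why it might fail: It contains binary Goldbach with the Hardy–Littlewood main term for every large even N, given Q and the tuples: no method controls an individual shift h ≍ N; almost-all-h results (MRT 2019, window N^(8/33)) are the ceiling.
sources: GreenTao2010, HardyLittlewood1923, MatomakiRadziwillTao2019, MatomakiMerikoski2023, Literature.Barriers.Parity.CircleMethodBinary
[crux · DECLARED-RESIDUAL; node TupleUniformitySplit (lens-5 g3): shift-uniformity of the lower half
GIVEN bounded Siegel quality and the fixed-pattern lower half] Q → FixedLower → (uniform lower half
of GHL). Exactly the binary content of LQ — binary Goldbach for all large even N with the HL main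
term, and all moving-shift lower bounds — with the tuples split off: kernel
lowerGivenBoundedSiegel_iff : LQ ↔ (Q → FixedLower) ∧ this; WEAKER than LQ (world ¬(Q →
FixedLower)); FixedLower hypothesis load-bearing (T6). INSTRUMENTABLE: kernel
windowLower_of_fixedLower gives all shift windows ≫ εN from FixedLower_{d+1}; this item is
WINDOW(δN) → POINT; notch ladder = rungs (T11). -/
@[route_item "route-Parity-ArtinGenericSplit"]
def UniformLowerGivenFixed : Prop :=
  (∃ η₀ : ℝ, ∃ q₀ : ℕ, ∀ (q : ℕ) [NeZero q] (χ : DirichletCharacter ℂ q) (η : ℝ), q₀ ≤ q → Literature.Barriers.Parity.IsSiegelZero χ η → η < η₀) → (∀ (d t : ℕ), 1 ≤ d → 1 ≤ t → ∀ Ψ : Fin t → Literature.NumberTheory.Sieve.AffLinForm d, Literature.NumberTheory.Sieve.IsNondegenerateSystem Ψ → ∀ ε : ℝ, 0 < ε → ∃ N₀ : ℕ, ∀ N : ℕ, N₀ ≤ N → ∀ K : Set (Fin d → ℝ), Convex ℝ K → K ⊆ Literature.NumberTheory.Sieve.realBox d N → Literature.NumberTheory.Sieve.archFactor Ψ K *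 Literature.NumberTheory.Sieve.singularProduct Ψ - Literature.NumberTheory.Sieve.vonMangoldtSum Ψ K N ≤ ε * (N : ℝ) ^ d) → ∀ (d t L : ℕ), 1 ≤ d → 1 ≤ t → ∀ ε : ℝ, 0 < ε → ∃ N₀ : ℕ, ∀ N : ℕ, N₀ ≤ N → ∀ Ψ : Fin t → Literature.NumberTheory.Sieve.AffLinForm d, Literature.NumberTheory.Sieve.IsNondegenerateSystem Ψ → Literature.NumberTheory.Sieve.affLinSize Ψ N ≤ L → ∀ K : Set (Fin d → ℝ), Convex ℝ K → K ⊆ Literature.NumberTheory.Sieve.realBox d N → Literature.NumberTheory.Sieve.archFactor Ψ K * Literature.NumberTheory.Sieve.singularProduct Ψ - Literature.NumberTheory.Sieve.vonMangoldtSum Ψ K N ≤ ε * (N : ℝ) ^ d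

/-- item stmt-Parity-26853 · crux · rank 5 · open · by planner
why it might fail: It is the uniform-in-shift (binary Goldbach-type) upper bound with factor 1+ε given Q and all tuples: pointwise-in-h control beyond windows N^(8/33) (MRT 2019) is open; the circle method misses binary minor arcs by log x.
sources: GreenTao2010, MatomakiRadziwillTao2019, MatomakiMerikoski2023, Literature.Barriers.Parity.TrueComplexityBinary, Literature.Barriers.Parity.CircleMethodBinary
[crux · DECLARED-RESIDUAL; node TupleUniformitySplit (lens-5 g3): shift-uniformity of the upper half
GIVEN bounded Siegel quality and the fixed-pattern upper half] Q → FixedUpper → (uniform upper half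
of GHL: one N₀(d,t,L,ε) for all Ψ with ‖Ψ‖_N ≤ L). Exactly the binary / moving-target content of UQ
(Goldbach-type systems (n, N−n), shifts h ≍ N) with the tuple content split off: kernel
upperGivenBoundedSiegel_iff : UQ ↔ (Q → FixedUpper) ∧ this, so WEAKER than UQ (separating world ¬(Q
→ FixedUpper)) and the FixedUpper hypothesis is load-bearing (T6). Transpose of the PairsToGHL cut
(9389: pairs-uniform base, tuples residual). INSTRUMENTABLE: kernel windowUpper_of_fixedUpper —
FixedUpper in dimension d+1 already gives every shift-WINDOW average of length ≫ εN; this item is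
WINDOW(δN) → POINT; notches N^{8/33} (MRT) → N^{7/30} (ShiftTauberian) → polylog are rungs (T11),
not filed. -/
@[route_item "route-Parity-ArtinGenericSplit"]
def UniformUpperGivenFixed : Prop :=
  (∃ η₀ : ℝ, ∃ q₀ : ℕ, ∀ (q : ℕ) [NeZero q] (χ : DirichletCharacter ℂ q) (η : ℝ), q₀ ≤ q → Literature.Barriers.Parity.IsSiegelZero χ η → η < η₀) → (∀ (d t : ℕ), 1 ≤ d → 1 ≤ t → ∀ Ψ : Fin t → Literature.NumberTheory.Sieve.AffLinForm d, Literature.NumberTheory.Sieve.IsNondegenerateSystem Ψ → ∀ ε : ℝ, 0 < ε → ∃ N₀ : ℕ, ∀ N : ℕ, N₀ ≤ N → ∀ K : Set (Fin d → ℝ), Convex ℝ K → K ⊆ Literature.NumberTheory.Sieve.realBox d N → Literature.NumberTheory.Sieve.vonMangoldtSum Ψ K N - Literature.NumberTheory.Sieve.archFactor Ψ K * Literature.NumberTheory.Sieve.singularProduct Ψ ≤ ε * (N : ℝ) ^ d) → ∀ (d t L : ℕ), 1 ≤ d → 1 ≤ t → ∀ ε : ℝ, 0 < ε → ∃ N₀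 : ℕ, ∀ N : ℕ, N₀ ≤ N → ∀ Ψ : Fin t → Literature.NumberTheory.Sieve.AffLinForm d, Literature.NumberTheory.Sieve.IsNondegenerateSystem Ψ → Literature.NumberTheory.Sieve.affLinSize Ψ N ≤ L → ∀ K : Set (Fin d → ℝ), Convex ℝ K → K ⊆ Literature.NumberTheory.Sieve.realBox d N → Literature.NumberTheory.Sieve.vonMangoldtSum Ψ K N - Literature.NumberTheory.Sieve.archFactor Ψ K * Literature.NumberTheory.Sieve.singularProduct Ψ ≤ ε * (N : ℝ) ^ d

/-- item stmt-Parity-25148 · crux · rank 6 · open · by planner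
why it might fail: it is the Landau–Siegel problem: no unconditional bound on η is known (Siegel's theorem is ineffective); a genuine open problem, not a lemma.
sources: HeathBrown1983PrimeTwins, MatomakiMerikoski2023, TaoTeravainen2021
[crux] Siegel zeros of primitive quadratic characters have bounded quality at all large conductors:
∃ η₀ q₀, every Siegel zero (IsSiegelZero χ η) of conductor q ≥ q₀ has η < η₀ — literally
¬UnboundedSiegelZeros (Landau–Siegel in the form the MM bridge needs). [difficulty: open-problem] ‖
TAG [crit-1 CLEARED 2026-08-30T01:46:27Z, HOME/STATUS.md l.26]: WEAKER (kernel mod MM2023 print; Q ⟹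
GHL unknown); leaf IDEA-NEEDED (Landau–Siegel) + ATTACKABLE-rung (Zhang2022 skeleton routes
PrimeLevelFamEdge/ZDegreeToeplitzBand; lens-2 T_ω ladder) + INSTRUMENTABLE (finite conductor tables,
not a rung). BC3 birth skeleton: stub_weakGoldbach (WeakHLGoldbachConj ½, open) → stub_exclusion
(MM2023 Cor 1.2 Goldbach detector + |L'| ≪ log²q, provable-now) → Q. Census
HOME/census/COSTUME-CENSUS-v1.md sha256
4afbbbc68c038369818dcc2bcc5990569ac50a4757d8938468c0838377ddd628 row WK8. -/
@[route_item "route-Parity-ArtinGenericSplit"]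
def BoundedSiegelZeroQuality : Prop :=
  ∃ η₀ : ℝ, ∃ q₀ : ℕ, ∀ (q : ℕ) [NeZero q] (χ : DirichletCharacter ℂ q) (η : ℝ), q₀ ≤ q → Literature.Barriers.Parity.IsSiegelZero χ η → η < η₀

/-- item stmt-Parity-26852 · crux · rank 7 · open · by planner
why it might fail: As a target it contains the upper prime k-tuples bound with constant 1+ε for every fixed tuple: Type-I sieves stop at factor 2 (Selberg parity, LinearSieveOptimality); record 3.2996 for twins; open even under GRH.
sources: GreenTao2010, HardyLittlewood1923, Selberg1949, Literature.Barriers.Parity.SelbergParity, Literature.Barriers.Parity.LinearSieveOptimality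
[crux; node TupleUniformitySplit (lens-5 g3, crit-1 CLEARED 2026-08-30T03:41:11Z STATUS l.116),
quantifier-order cut of UQ: the FIXED-PATTERN upper half] For every FIXED non-degenerate
affine-linear system Ψ (all d, t; quantifier order ∀Ψ ∃N₀, no size bound) and ε > 0, eventually in N
and uniformly in convex K ⊆ [−N,N]^d: Σ_{n∈K} ∏Λ(ψ_i(n)) − β_∞(Ψ,K)·∏β_p(Ψ) ≤ εN^d. OPEN CONTENT =
INFINITE complexity only (two affinely dependent forms: the k-tuple translates n+h_1,…,n+h_k and
their fibrations; d = 1 translate face = upper prime k-tuples in Λ-form, all k); finite-complexity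
systems are the Green–Tao–Ziegler THEOREM — the AP face is not progress (critic N2). WEAKER than UQ
and than the uniform upper half (kernel: necessity fixedUpper_of_ghl; Goldbach-vacuity
fixed_holds_goldbachPair — (n, c−n) satisfies it trivially, so no binary content; Siegel-INERT:
fixed-shift HL holds near exceptional scales, MatomakiMerikoski2023_fixedShift / Heath-Brown 1983 /
Tao–Teräväinen, while USZ refutes the uniform half) — hence typed BARE (record T1 logic). Leaf
BARRIER head-on (target constant 1; Type-I sieve ceiling 2 even under EH: SelbergParity,
LinearSieveOptimality); FU is ⊠-closed, so a constan -/
@[route_item "route-Parity-ArtinGenericSplit"]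
def FixedUpper : Prop :=
  ∀ (d t : ℕ), 1 ≤ d → 1 ≤ t → ∀ Ψ : Fin t → Literature.NumberTheory.Sieve.AffLinForm d, Literature.NumberTheory.Sieve.IsNondegenerateSystem Ψ → ∀ ε : ℝ, 0 < ε → ∃ N₀ : ℕ, ∀ N : ℕ, N₀ ≤ N → ∀ K : Set (Fin d → ℝ), Convex ℝ K → K ⊆ Literature.NumberTheory.Sieve.realBox d N → Literature.NumberTheory.Sieve.vonMangoldtSum Ψ K N - Literature.NumberTheory.Sieve.archFactor Ψ K * Literature.NumberTheory.Sieve.singularProduct Ψ ≤ ε * (N : ℝ) ^ d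

/-- item stmt-Parity-30688 · assembly · rank 1 · closed · proved by Summit.Parity.GeneralizedHardyLittlewood.Theses.ArtinGenericSplit.assembly_proof (prover) · by planner
sources: GreenTao2010, Hooley1967
[assembly] BoundedSiegelZeroQuality → FixedUpper → UniformUpperGivenFixed → ArtinTwo → ArtinLift →
UniformLowerGivenFixed → GeneralizedHardyLittlewood -/
@[route_item "route-Parity-ArtinGenericSplit"]
def Assembly : Prop :=
  BoundedSiegelZeroQuality → FixedUpper → UniformUpperGivenFixed → ArtinTwo → ArtinLift → UniformLowerGivenFixed → GeneralizedHardyLittlewood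

-- `Assembly` holds: proved by `Summit.Parity.GeneralizedHardyLittlewood.Theses.ArtinGenericSplit.assembly_proof` (its module imports this route file, so no `_holds` link can be stated here).

/-! D-0027 §2.1 — DECIDING THEOREM (planner-authored via `route open/edit --closes-file`; by planner-decomp-parity-lens-2-g6-0 2026-08-30T08:02:50Z):
its hypotheses are this route's items and its conclusion the sub-problem Statement (glue_lint), and it elaborates with this file. -/

@[closes "route-Parity-ArtinGenericSplit"] theorem closes (hQ : BoundedSiegelZeroQuality) (hFU : FixedUpper) (hUU : UniformUpperGivenFixed)
    (hA : ArtinTwo) (hR : ArtinLift) (hUL : UniformLowerGivenFixed) : GeneralizedHardyLittlewood := by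
  intro d t L hd ht ε hε
  obtain ⟨N₁, h₁⟩ := hUU hQ hFU d t L hd ht ε hε
  obtain ⟨N₂, h₂⟩ := hUL hQ (hR hA) d t L hd ht ε hε
  refine ⟨max N₁ N₂, fun N hN Ψ hΨ hΨL K hK hKN => abs_sub_le_iff.mpr ⟨?_, ?_⟩⟩
  · exact h₁ N (le_trans (le_max_left _ _) hN) Ψ hΨ hΨL K hK hKN
  · exact h₂ N (le_trans (le_max_right _ _) hN) Ψ hΨ hΨL K hK hKN

end Summit.Parity.GeneralizedHardyLittlewood.Theses.ArtinGenericSplit
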